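import Summits.QuantumFields.YangMills.Theorems.IR.ShellMaxCorrRungReduction
import Summits.QuantumFields.YangMills.Theorems.IR.ShellMaxCorrRung
import Literature.MathematicalPhysics.QuantumFieldTheory.Balaban1983to89.StrongCouplingTorusWindow
import Literature.Probability.LatticeModels.DobrushinComparisonBoundary
import HarnessLib

/-!
# Crux `IR` (item stmt-QuantumFields-19354) — STUB PLAN for the registered stub `ShellMaxCorr.stub_shellRung : ShellRung`
(line of record «shell-maxcorr-doubling», lead ym-ir-line-mxc-p1; skeleton `Cruxes/IR/Lines/shell_maxcorr_doubling.lean`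
is NOT touched).  Author: ideator ym-ir-idea-1 (generation 3).  This file is a typed DECOMPOSITION of the one input the
lead recorded as missing in `Theorems/IR/ShellMaxCorrRungReduction.lean` — an `R`-UNIFORM bound `≤ 1/2` on the maximal
correlation of the two ADJACENT sphere layers `σ(S_R)`, `σ(S_{R+1})` of the torus Wilson state at small `|β|` — into five
standard-tool stubs, with the kernel-checked composition `shellRung_of_DA : … → ShellRung` through the landed
`shellRung_of_layers`.

THE MECHANISM («Dobrushin in KR currency + data-augmentation self-adjointness ⇒ a PURE-L² bound with no volume factor»):
let `U := γ_{Λ_out}` be the DLR kernel of the outer volume `Λ_out = {links not in the closed ball B_R}` (it maps a bounded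
`S_{R+1}`-observable `g` to a version of `E_μ[g | links of B_R]`, which reads only the layer `S_R`), and `K := γ_{Λ_in} ∘ U`
with `Λ_in = {links not outside the open ball of radius R+1}` (so `K g` reads only `S_{R+1}` again).  Then
(1) LOCALITY: `U g` reads `S_R`, `K g` reads `S_{R+1}` (plaquette closure; the lead's `plaquette_layer(_inner)` geometry);
(2) DLR IDENTITIES: `∫ f g dμ = ∫ f (U g) dμ` for `f` reading `B_R`, `⟨K h₁, h₂⟩_μ = ⟨U h₁, U h₂⟩_μ` (so `K` is SYMMETRIC on
    `S_{R+1}`-observables and `⟨g, K g⟩ = ‖U g‖²`), `∫ K g = ∫ g` — all instances of `integral_specAvg(_mul)`;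
(3) CONTRACTION (the only model input; Dobrushin 1968 / Föllmer 1982 comparison in Kantorovich–Rubinstein currency, as
    typed in the tree: `isKRContraction_torusWeightSpec_linear` + `abs_kernel_sub_le_of_superSolution` with the geometric
    super-solution `d_z = α₀^{dist(z,y)}` and the `ℤ⁴` ball count): for `|β| ≤ β₀(G, ρ)` the uniform one-link oscillation
    `ℓ(·)` contracts, `ℓ(U g) ≤ ℓ(g)/2`, `ℓ(γ_{Λ_in} u) ≤ ℓ(u)/2`, uniformly in the torus size and in `R`;
(4) LOG-CONVEXITY (elementary): a log-convex sequence dominated by `A θ^s` has `b₁ ≤ θ b₀`;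
(5) ASSEMBLY (pure measure theory): `b_s := σ(K^s g)` is log-convex by symmetry + Cauchy–Schwarz, and `b_s ≤ 2C|S_{R+1}|4^{-s}`
    by (1)+(3) (the volume factor sits in `A`, which (4) discards); hence `σ(K g) ≤ σ(g)/4`, `Var(U g) = Cov(g, K g) ≤ σ(g)²/4`,
    `|Cov(f,g)| = |Cov(f, U g)| ≤ σ(f) σ(U g) ≤ ½ σ(f) σ(g)` — the hypothesis of `shellRung_of_layers`.
Why this answers the recorded gap: the classical Dobrushin/Künsch/Föllmer covariance bounds carry oscillation norms or a factor
`|Λ_f||Λ_g|`; here the oscillation currency is used only for the DECAY RATE of `‖K^s g‖₂`, and the prefactor is removed by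
log-convexity of `s ↦ ‖K^s g‖₂` for the self-adjoint positive operator `K = U*U` (the data-augmentation operator, whose norm is
the squared maximal correlation: Liu–Wong–Kong 1994; `W₁`-contraction ⇒ `L²`-gap for reversible kernels: Ollivier 2009 Prop. 30,
M.-F. Chen–F.-Y. Wang 1994).  No spectral theorem, no coupling construction is needed in Lean.

HONEST FRAMING: a plan (five typed packages, RETIRED unproved since the target rung landed by another route — see §stubs; + a sorry-free composition), not a proof; `ShellRung` is the BC5 rung of a
CONDITIONAL rung line whose loads (`IRShellCorr` at the physical scale) stay open; nothing here proves or claims the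
Yang–Mills mass gap (Clay), and R4 of the ladder closes only the conditional finite-𝕋⁴ rung `BalabanLadder.UV`.
Refs: Dobrushin, Theory Probab. Appl. 13 (1968) 197; Föllmer, J. Funct. Anal. 46 (1982) 387 and LNM 1362 (1988) Ch. I;
Georgii, de Gruyter 2011, Def. 1.23, Prop. 8.8; Liu–Wong–Kong, Biometrika 81 (1994) 27; Ollivier, J. Funct. Anal. 256 (2009)
810, Prop. 30 [arXiv:math/0701886]; Chen–Wang, J. Funct. Anal. 121 (1994).
-/

set_option autoImplicit false

noncomputable section

open Filter Topology MeasureTheory ProbabilityTheory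
open Literature.MathematicalPhysics.QuantumFieldTheory Literature.MathematicalPhysics.QuantumLattice
open Literature.MathematicalPhysics.QuantumFieldTheory.Balaban1983to89.StrongCouplingTorusWindow (specAvg)
open Literature.Probability.LatticeModels (Specification)
open Literature.Probability.LatticeModels.DobrushinMetric (IsLipBound)

namespace Summit.QuantumFields.YangMills.Cruxes.IR.ShellMaxCorr.RungDA

/-! ## §1 Objects: the Wilson plaquette weight, the two DLR smoothings, the uniform one-link oscillation -/

section Objects

variable {G : Type} [Group G] [TopologicalSpace G] [IsTopologicalGroup G] [CompactSpace G] [T2Space G]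
  [SecondCountableTopology G] [MeasurableSpace G] [BorelSpace G]

/-- The Wilson plaquette weight of `(ρ, β)`: `v(h) = exp(−β (n − Re tr ρ(h)))`, so that `∏_q v(U_q) = exp(−β S_W(U))` with the
tree's `wilsonAction ρ`. -/
def plaqWeight {n : ℕ} (ρ : G →* Matrix (Fin n) (Fin n) ℂ) (β : ℝ) (h : G) : ℝ :=
  Real.exp (-(β * ((n : ℝ) - (ρ h).trace.re)))

/-- The torus Wilson specification of `(ρ, β)` in `d = 4`, side `N`, as a plaquette-weight specification
(`torusWeightSpec`, for which the Dobrushin–KR contraction `isKRContraction_torusWeightSpec_linear` is in the tree). -/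
def wSpec {n : ℕ} (ρ : G →* Matrix (Fin n) (Fin n) ℂ) (β : ℝ) (N : ℕ) [NeZero N] : Specification (Edge 4 N) G :=
  torusWeightSpec (d := 4) (L := N) (plaqWeight ρ β)

open Classical in
/-- The outer volume `Λ_out(R)`: links NOT in the closed sup-ball `B_R` (its DLR kernel conditions on the links of `B_R`). -/
def outVol (N : ℕ) [NeZero N] (R : ℕ) : Finset (Edge 4 N) := Finset.univ.filter fun e => ¬ InBall R e

open Classical in
/-- The inner volume `Λ_in(R)`: links NOT outside the open sup-ball of radius `R + 1` (its DLR kernel conditions on the links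
outside that open ball). -/
def inVol (N : ℕ) [NeZero N] (R : ℕ) : Finset (Edge 4 N) := Finset.univ.filter fun e => ¬ OutBall (R + 1) e

/-- The OUTER smoothing `U_R g := γ_{Λ_out(R)} g` (a version of `E_μ[g | links of B_R]`; for `g` reading `S_{R+1}` it reads only
the layer `S_R`). -/
def outerAvg {n : ℕ} (ρ : G →* Matrix (Fin n) (Fin n) ℂ) (β : ℝ) (N : ℕ) [NeZero N] (R : ℕ)
    (g : GaugeConfig 4 N G → ℝ) : GaugeConfig 4 N G → ℝ :=
  specAvg (wSpec ρ β N) (outVol N R) g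

/-- The INNER smoothing `γ_{Λ_in(R)} u` (a version of `E_μ[u | links outside the open ball of radius R+1]`; for `u` reading
`S_R` it reads only `S_{R+1}`). -/
def innerAvg {n : ℕ} (ρ : G →* Matrix (Fin n) (Fin n) ℂ) (β : ℝ) (N : ℕ) [NeZero N] (R : ℕ)
    (u : GaugeConfig 4 N G → ℝ) : GaugeConfig 4 N G → ℝ :=
  specAvg (wSpec ρ β N) (inVol N R) u

/-- The data-augmentation step `K_R := γ_{Λ_in(R)} ∘ γ_{Λ_out(R)}` on `S_{R+1}`-observables. -/
def daStep {n : ℕ} (ρ : G →* Matrix (Fin n) (Fin n) ℂ) (β : ℝ) (N : ℕ) [NeZero N] (R : ℕ)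
    (g : GaugeConfig 4 N G → ℝ) : GaugeConfig 4 N G → ℝ :=
  innerAvg ρ β N R (outerAvg ρ β N R g)

/-- Uniform one-link oscillation bound `ℓ(f) ≤ c`: `|f σ − f τ| ≤ c` whenever `σ = τ` off one link (the tree's `IsLipBound`
for the discrete weight `r ≡ 1` with a constant profile). -/
def UnifOsc {N : ℕ} (f : GaugeConfig 4 N G → ℝ) (c : ℝ) : Prop :=
  IsLipBound (fun _ _ : G => (1 : ℝ)) f (fun _ : Edge 4 N => c)

end Objects

/-! ## §2 The five stub statements and the target hypothesis of `shellRung_of_layers` -/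

/-- STUB 1 (locality, size S): the outer smoothing of a bounded measurable `S_{R+1}`-observable is measurable, keeps the bound
and reads only `S_R`; the inner smoothing of a bounded measurable `S_R`-observable is measurable, keeps the bound and reads only
`S_{R+1}`.  Tools: `measurable_specAvg`, `abs_specAvg_le`, `dependsOn_specAvg_torusWeightSpec` (plaquette closure) and the
lead's `plaquette_layer` / `plaquette_layer_inner`. -/
def LocalityPkg : Prop :=
  ∀ (G : Type) [Group G] [TopologicalSpace G] [IsTopologicalGroup G] [CompactSpace G] [T2Space G]
    [SecondCountableTopology G] [MeasurableSpace G] [BorelSpace G] (n : ℕ) (ρ : G →* Matrix (Fin n) (Fin n) ℂ),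
    Continuous ρ → ∀ (β : ℝ) (N : ℕ) [NeZero N] (R : ℕ),
      (∀ g : GaugeConfig 4 N G → ℝ, Measurable g → (∃ C, ∀ U, |g U| ≤ C) →
          DependsOn g {e | InBall (R + 1) e ∧ OutBall (R + 1) e} →
            Measurable (outerAvg ρ β N R g) ∧ (∀ C : ℝ, (∀ U, |g U| ≤ C) → ∀ U, |outerAvg ρ β N R g U| ≤ C) ∧
              DependsOn (outerAvg ρ β N R g) {e | InBall R e ∧ OutBall R e}) ∧
      (∀ u : GaugeConfig 4 N G → ℝ, Measurable u → (∃ C, ∀ U, |u U| ≤ C) →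
          DependsOn u {e | InBall R e ∧ OutBall R e} →
            Measurable (innerAvg ρ β N R u) ∧ (∀ C : ℝ, (∀ U, |u U| ≤ C) → ∀ U, |innerAvg ρ β N R u U| ≤ C) ∧
              DependsOn (innerAvg ρ β N R u) {e | InBall (R + 1) e ∧ OutBall (R + 1) e})

/-- STUB 2 (DLR identities, size S/M): the torus Wilson measure is a Gibbs measure for `wSpec ρ β N`
(`wilsonMeasure ρ β = groupHeatKernelMeasure (fun _ => plaqWeight ρ β) 0`, `isGibbsMeasure_groupHeatKernelMeasure`), hence the
pull-out identities `integral_specAvg_mul` for the two smoothings and the DLR equation `integral_specAvg`. -/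
def DLRPkg : Prop :=
  ∀ (G : Type) [Group G] [TopologicalSpace G] [IsTopologicalGroup G] [CompactSpace G] [T2Space G]
    [SecondCountableTopology G] [MeasurableSpace G] [BorelSpace G] (n : ℕ) (ρ : G →* Matrix (Fin n) (Fin n) ℂ),
    Continuous ρ → ∀ (β : ℝ) (N : ℕ) [NeZero N] (R : ℕ),
      (∀ f g : GaugeConfig 4 N G → ℝ, Measurable f → Measurable g → (∃ C, ∀ U, |f U| ≤ C) → (∃ C, ∀ U, |g U| ≤ C) →
          DependsOn f {e | InBall R e} →
            ∫ U, f U * g U ∂(wilsonMeasure (d := 4) (L := N) ρ β) =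
              ∫ U, f U * outerAvg ρ β N R g U ∂(wilsonMeasure (d := 4) (L := N) ρ β)) ∧
      (∀ h u : GaugeConfig 4 N G → ℝ, Measurable h → Measurable u → (∃ C, ∀ U, |h U| ≤ C) → (∃ C, ∀ U, |u U| ≤ C) →
          DependsOn h {e | OutBall (R + 1) e} →
            ∫ U, h U * u U ∂(wilsonMeasure (d := 4) (L := N) ρ β) =
              ∫ U, h U * innerAvg ρ β N R u U ∂(wilsonMeasure (d := 4) (L := N) ρ β)) ∧
      (∀ g : GaugeConfig 4 N G → ℝ, Measurable g → (∃ C, ∀ U, |g U| ≤ C) →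
          ∫ U, outerAvg ρ β N R g U ∂(wilsonMeasure (d := 4) (L := N) ρ β) =
              ∫ U, g U ∂(wilsonMeasure (d := 4) (L := N) ρ β) ∧
            ∫ U, innerAvg ρ β N R g U ∂(wilsonMeasure (d := 4) (L := N) ρ β) =
              ∫ U, g U ∂(wilsonMeasure (d := 4) (L := N) ρ β))

/-- STUB 3 (the Dobrushin input, size M): at small `|β|` (depending on `G, ρ` only) both smoothings HALVE the uniform one-link
oscillation of layer observables, uniformly in the torus size `N` and the radius `R`.  Tools: `isKRContraction_torusWeightSpec_linear`
(`δ = osc log v = |β| · osc(Re tr ρ)`, row sums `≤ 9δ` by `sum_linkNbrT_coeff_le_linear`), `abs_kernel_sub_le_of_superSolution` with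
the geometric super-solution `d_z = α₀^{ℓ_y(z)}` (`exists_linkProfile`, valid once `9δ ≤ α₀`) and the ball count
`Σ_{k ≥ 1} 4 (2k+1)⁴ α₀^k ≤ 1/2` (e.g. `α₀ = 10⁻³`). -/
def ContractionPkg : Prop :=
  ∀ (G : Type) [Group G] [TopologicalSpace G] [IsTopologicalGroup G] [CompactSpace G] [T2Space G]
    [SecondCountableTopology G] [MeasurableSpace G] [BorelSpace G] (n : ℕ) (ρ : G →* Matrix (Fin n) (Fin n) ℂ),
    Continuous ρ → ∃ β₀ : ℝ, 0 < β₀ ∧ ∀ β : ℝ, |β| ≤ β₀ → ∀ (N : ℕ) [NeZero N] (R : ℕ),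
      (∀ (g : GaugeConfig 4 N G → ℝ) (c : ℝ), Measurable g → (∃ C, ∀ U, |g U| ≤ C) →
          DependsOn g {e | InBall (R + 1) e ∧ OutBall (R + 1) e} → UnifOsc g c →
            UnifOsc (outerAvg ρ β N R g) (c / 2)) ∧
      (∀ (u : GaugeConfig 4 N G → ℝ) (c : ℝ), Measurable u → (∃ C, ∀ U, |u U| ≤ C) →
          DependsOn u {e | InBall R e ∧ OutBall R e} → UnifOsc u c →
            UnifOsc (innerAvg ρ β N R u) (c / 2))

/-- STUB 4 (elementary, size S): a nonnegative LOG-CONVEX sequence dominated by a geometric one, `b_s ≤ A θ^s`, has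
`b₁ ≤ θ b₀` (the prefactor `A` is discarded: `b_s ≥ b₀ (b₁/b₀)^s`). -/
def LogConvexDecay : Prop :=
  ∀ (b : ℕ → ℝ) (A θ : ℝ), (∀ s, 0 ≤ b s) → 0 ≤ θ → (∀ s, b (s + 1) ^ 2 ≤ b s * b (s + 2)) →
    (∀ s, b s ≤ A * θ ^ s) → b 1 ≤ θ * b 0

/-- The TARGET: the hypothesis of the landed `shellRung_of_layers` (adjacent-layers maximal correlation `≤ 1/2`, uniformly). -/
def LayerPairHalf : Prop :=
  ∀ (G : Type) [Group G] [TopologicalSpace G] [IsTopologicalGroup G] [CompactSpace G] [T2Space G]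
    [SecondCountableTopology G] [MeasurableSpace G] [BorelSpace G] (n : ℕ) (ρ : G →* Matrix (Fin n) (Fin n) ℂ),
    Continuous ρ → ∃ β₀ : ℝ, 0 < β₀ ∧ ∀ β : ℝ, |β| ≤ β₀ → ∀ S R : ℕ,
      ∀ f g : GaugeConfig 4 (2 * S + 1) G → ℝ, Measurable f → Measurable g →
        (∃ C, ∀ U, |f U| ≤ C) → (∃ C, ∀ U, |g U| ≤ C) →
        DependsOn f {e | InBall R e ∧ OutBall R e} → DependsOn g {e | InBall (R + 1) e ∧ OutBall (R + 1) e} →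
          |cov[f, g; wilsonMeasure (d := 4) (L := 2 * S + 1) ρ β]| ≤
            1 / 2 * Real.sqrt (Var[f; wilsonMeasure (d := 4) (L := 2 * S + 1) ρ β]) *
              Real.sqrt (Var[g; wilsonMeasure (d := 4) (L := 2 * S + 1) ρ β])

/-- STUB 5 (the data-augmentation / power-trick assembly, size M, pure measure theory given the four packages): with
`K = innerAvg ∘ outerAvg`, `b_s := σ(K^s g)` is log-convex (symmetry of `K` from STUB 2 + Cauchy–Schwarz `abs_cov_le_sqrt_var`),
`b_s ≤ 2C |S_{R+1}| 4^{-s}` (STUBS 1, 3 and `IsLipBound.abs_sub_le_mul_sum_of_dependsOn`), so STUB 4 gives `σ(K g) ≤ σ(g)/4`;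
then `Var(outerAvg g) = Cov(g, K g) ≤ σ(g)²/4` and `|Cov(f, g)| = |Cov(f, outerAvg g)| ≤ ½ σ(f) σ(g)` (STUB 2). -/
def DAAssembly : Prop :=
  LocalityPkg → DLRPkg → ContractionPkg → LogConvexDecay → LayerPairHalf

/-! ## §3 The stubs (sorried) and the kernel-checked composition -/

-- SUPERSEDED (LEAD ym-ir-line-mxc-p1 g4, 2026-08-28): the five plan stubs `stub_locality`, `stub_dlr`, `stub_contraction`,
-- `stub_logConvexDecay`, `stub_daAssembly` (formerly `sorry` here) are RETIRED unproved — the rung `ShellRung` they were planned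
-- for is the tree theorem `ShellMaxCorr.stub_shellRung` (LEAD g2, p596102, route: Dobrushin ⇒ dimension-free heat-bath Poincaré +
-- Bessel/Schur one-link tilt, `Theorems/IR/ShellMaxCorrRung.lean`), so this DA-chain plan is an unneeded alternative.  The typed
-- packages `LocalityPkg` … `DAAssembly` and the sorry-free composition `shellRung_of_DA` below are kept as documentation of the
-- alternative route; nothing in this file is registered.

/-- COMPOSITION (sorry-free): the five stubs give `ShellRung` through the landed reduction `shellRung_of_layers`. -/
theorem shellRung_of_DA (h₁ : LocalityPkg) (h₂ : DLRPkg) (h₃ : ContractionPkg) (h₄ : LogConvexDecay)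
    (h₅ : DAAssembly) : ShellRung :=
  shellRung_of_layers (h₅ h₁ h₂ h₃ h₄)

/-- `ShellRung` itself: the tree theorem (LEAD g2, p596102) — this plan's target is closed in the tree by another route. -/
theorem shellRung_via_tree : ShellRung := stub_shellRung

end Summit.QuantumFields.YangMills.Cruxes.IR.ShellMaxCorr.RungDA

end
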